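import Summits.QuantumFields.YangMills.Theorems.BalabanUVNodesN15KingModelBlockTreeEngine
import Summits.QuantumFields.YangMills.Theorems.BalabanUVNodesN15KingModelCovariantLaplacian
import Literature.MathematicalPhysics.QuantumFieldTheory.King1986.TorusBlockForm
import HarnessLib

/-!
# BalabanUVNodes ∕ N15 — THE KING-MODEL RUNG (PART Ϥ-b): TREE CONTOUR SYSTEMS ON KING's BLOCKS AND THEIR PARALLEL TRANSPORTS — the contours `Γ_{y,x}` of
# [Balaban1984PropagatorsI] (1.7) p.18 ∕ [King1986] (2.12) p.653 as a rooted tree on the offsets of a block, the COMB (first along `e₀`, then `e₁`, …) as the instance, and the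
# transport `U(Γ_{y,x})` of an ARBITRARY link field `U` along the contour (ordered product; any fibre `𝕜ⁿ`, abelian or not): unitary, `= 1` at `U ≡ 1`, GAUGE COVARIANT
# `U^g(Γ_{y,x}) = g(y)U(Γ_{y,x})g(x)^*` ([B9] (3.32) p.395 «R(U^u(Γ_{y,x})) = R(u(y))R(U(Γ_{y,x}))R(u^{−1}(x))»)
# (Track A, DAG node N15 = NE2; FAN-OUT v1.1 §N15 s3 «KING-MODEL RUNG … + what the curved case adds»; count-neutral)

HONEST FRAMING.  Count-neutral (cell `pub-ymgap`, seat `pub-ymgap-dag-n15-e` g49; `--supports stmt-QuantumFields-27247 --as helper` = K3ᴬ, KEY MAP v3).  King's torus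
`T_η = Π_μℤ∕(L·M_μ)` with its `L`-blocks `site L M b j = L·b + j` (tree `King1986.Torus.site`, `blockEquiv`; `= B5Block118.bpt`), link fields `U : T_η × Fin(d+1) → Mat_n(𝕜)` as in
PART Ͱ-a (`covLapF`, `kingGaugeAct`).  ONE-STEP contours over one block level (the `k = 1` case of King's nested (2.12); King's `k`-level nested contours form another tree
contour system in the sense of §1 — not typed here); NOT Bałaban's multi-level `Q_k(U)` of (3.15); NOT a node discharge (N15 of record untouched); nothing continuum ∕ ℝ⁴ ∕ OS ∕ Clay.

THE OBJECTS.  §1 A TREE CONTOUR SYSTEM on the offsets `j ∈ {0,…,L−1}^{d+1}` of a block (`BlockTree d L`): a rooted tree (PART Ϥ-a) with root `0` together with the AXIS of the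
last bond of each contour, subject to «`j` = `parent j` advanced by one step along `axis j`»; then `site b j = site b (parent j) + e_{axis j}` on the fine torus (`site_eq_parent_add_unitVec`)
and the contour bonds `(site b (parent j), axis j)`, `j ≠ 0`, are pairwise distinct (`treeBond_injective`).  §2 THE COMB `kingComb d L`: `depth j = Σ_μ j_μ`, `axis j` = the LARGEST `μ`
with `j_μ ≠ 0`, `parent j = j − e_{axis j}` — the contour from the corner first runs along `e₀`, then `e₁`, … ([Balaban1984PropagatorsI] (1.7): «Γ_{y,x} … first in the direction
`e₁` … then `e₂` …»; [Federbush1987PhaseCellIII] §5.3 p.303 «the Balaban axial gauge»; tree `Federbush1986.CombGaugeObservation.combTree` is the same comb on `ℤ^d` boxes);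
`depth ≤ (d+1)(L−1)`; on the comb every coordinate beyond the axis vanishes (`kingComb_apply_eq_zero_of_lt`).  §3 THE TRANSPORT `treeHol T U b j = U(Γ_{y,x})` (`y` = the corner
of block `b`, `x = site b j`): `U(Γ_{y,parent}) · U(site b parent, axis)` recursively (the factor nearest the corner leftmost; `U(x,μ)` carries the fibre at `x+e_μ` to `x`, PART Ͱ-a's
stencil), so `treeHol T U b j` maps the fibre at `site b j` to the fibre at the corner: `treeHol_root`, `treeHol_of_ne_root`, ★ `treeHol_mem_unitaryGroup`, ★ `treeHol_const_one`
(`U ≡ 1`: no transport, King's plain block mean), ★★ **`treeHol_kingGaugeAct`** ([B9] (3.32) BY NAME in the model: `U^g(Γ) = g(corner)·U(Γ)·g(site b j)^*`), `treeHol_congr_block`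
(the transport only reads `U` on the contour bonds of the block).
PRIOR TREE ART (by name): Ϥ-a (`RootedTree`, `depth_parent_lt`), Ͱ-a (`kingGaugeAct`), `King1986.Torus` (`site`, `site_injective`), `B5Prop11Plancherel` (`Tor`, `fine`, `unitVec`), Mathlib
(`Matrix.unitaryGroup`, `Finset.max'`, `Function.update`).  Dedup (rg at filing): basename 0 files; needles `BlockTree|kingComb|treeHol|treeBond_injective` 0 files in `Summits/QuantumFields/YangMills`
+ `Literature/MathematicalPhysics` (`combTree`∕`combParentMap` exist for Federbush's ℤ^d boxes — different carrier, cited).  presearch: n/a (definitions following the print).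
Locators: [Balaban1984PropagatorsI] (1.7) p.18; [Balaban1985BackgroundPropagators] (3.19) p.393, (3.32) p.395; [King1986] (2.11)–(2.12) p.653; [Federbush1987PhaseCellIII] §5.3 p.303.  0 `sorry`.
-/

noncomputable section
open scoped BigOperators
open Finset Matrix

namespace Summit.QuantumFields.YangMills.BalabanUVNodes.N15KingModelRung.CovariantBlock

open Literature.MathematicalPhysics.QuantumFieldTheory.Balaban1983to89.B5Prop11Plancherel (Tor fine unitVec)
open Literature.MathematicalPhysics.QuantumFieldTheory.King1986.Torus (site site_injective)
open Summit.QuantumFields.YangMills.BalabanUVNodes.N15KingModelRung.Covariant (kingGaugeAct)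

variable {d : ℕ} (L : ℕ) [NeZero L]

/-! ## §1 Tree contour systems on the offsets of a block -/

/-- A TREE CONTOUR SYSTEM on the offsets `{0,…,L−1}^{d+1}` of a block: a rooted tree with root the corner offset `0`, and for each `j ≠ 0` the AXIS of the last bond of the contour
`Γ_{0,j}`, with `j` = `parent j` advanced by one lattice step along `axis j`. [cite: Balaban1984PropagatorsI, (1.7) p.18; King1986, (2.12) p.653] -/
structure BlockTree (d L : ℕ) [NeZero L] extends RootedTree (Fin (d + 1) → Fin L) where
  root_eq : root = 0
  /-- the direction of the last bond of the contour to `j` -/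
  axis : (Fin (d + 1) → Fin L) → Fin (d + 1)
  step : ∀ j, j ≠ root → ∀ ν, ((j ν : ℕ)) = (parent j ν : ℕ) + (if ν = axis j then 1 else 0)

variable {L} (T : BlockTree d L) (M : Fin (d + 1) → ℕ) [hM : ∀ μ, NeZero (M μ)]

omit hM in
/-- ON THE FINE TORUS THE CONTOUR ADVANCES BY ONE BOND: `site b j = site b (parent j) + e_{axis j}` for `j ≠ 0`. [cite: Balaban1984PropagatorsI, (1.7) p.18] -/
theorem site_eq_parent_add_unitVec (b : Tor M) {j : Fin (d + 1) → Fin L} (hj : j ≠ T.root) :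
    site L M b j = site L M b (T.parent j) + unitVec (fine L M) (T.axis j) := by
  funext ν
  have hstep := T.step j hj ν
  simp only [site, Pi.add_apply, unitVec]
  by_cases hν : ν = T.axis j
  · subst hν
    rw [if_pos rfl] at hstep
    rw [Pi.single_eq_same, hstep]; push_cast; ring
  · rw [if_neg hν, add_zero] at hstep
    rw [Pi.single_eq_of_ne hν, hstep, add_zero]

/-- THE CONTOUR BONDS ARE DISTINCT: `(b, j) ↦ (site b (parent j), axis j)` is injective on `j ≠ 0` (a bond and its axis determine its far end `site b j`). [cite: Balaban1984PropagatorsI, (1.7) p.18] -/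
theorem treeBond_injective {b b' : Tor M} {j j' : Fin (d + 1) → Fin L} (hj : j ≠ T.root) (hj' : j' ≠ T.root)
    (h : (site L M b (T.parent j), T.axis j) = (site L M b' (T.parent j'), T.axis j')) : b = b' ∧ j = j' := by
  have h1 : site L M b (T.parent j) = site L M b' (T.parent j') := congrArg Prod.fst h
  have h2 : T.axis j = T.axis j' := congrArg Prod.snd h
  have h3 : site L M b j = site L M b' j' := by
    rw [site_eq_parent_add_unitVec T M b hj, site_eq_parent_add_unitVec T M b' hj', h1, h2]
  have := site_injective L M (a₁ := (b, j)) (a₂ := (b', j')) h3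
  simpa using this

omit hM in
/-- The root of a tree contour system is the corner offset. [cite: Balaban1984PropagatorsI, (1.7) p.18] -/
theorem BlockTree.root_eq_zero : T.root = 0 := T.root_eq

/-! ## §2 The comb -/

section Comb

variable (d)

/-- The comb depth `|j| = Σ_μ j_μ` (the number of bonds of the comb contour to `j`). [cite: Balaban1984PropagatorsI, (1.7) p.18] -/
def kingCombDepth (j : Fin (d + 1) → Fin L) : ℕ := ∑ μ, (j μ : ℕ)

/-- The comb axis of `j ≠ 0`: the LARGEST direction `μ` with `j_μ ≠ 0` (the comb contour runs along `e₀` first, then `e₁`, …, so its last bond is along the largest active direction);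
`0` for `j = 0`. [cite: Balaban1984PropagatorsI, (1.7) p.18; Federbush1987PhaseCellIII, §5.3 p.303] -/
def kingCombAxis (j : Fin (d + 1) → Fin L) : Fin (d + 1) :=
  if h : (univ.filter fun μ => j μ ≠ 0).Nonempty then (univ.filter fun μ => j μ ≠ 0).max' h else 0

/-- The comb parent of `j ≠ 0`: `j − e_{axis j}`; `0` for `j = 0`. [cite: Balaban1984PropagatorsI, (1.7) p.18] -/
def kingCombParent (j : Fin (d + 1) → Fin L) : Fin (d + 1) → Fin L :=
  if (univ.filter fun μ => j μ ≠ 0).Nonempty then Function.update j (kingCombAxis d j) ⟨(j (kingCombAxis d j) : ℕ) - 1, by omega⟩ else 0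

variable {d}

omit [NeZero L] in
/-- `j ≠ 0` iff some coordinate is non-zero. [folklore] -/
theorem filter_ne_zero_nonempty_iff [NeZero L] (j : Fin (d + 1) → Fin L) : (univ.filter fun μ => j μ ≠ 0).Nonempty ↔ j ≠ 0 := by
  constructor
  · rintro ⟨μ, hμ⟩ rfl
    simp at hμ
  · intro hj
    by_contra h
    rw [Finset.not_nonempty_iff_eq_empty, Finset.filter_eq_empty_iff] at h
    exact hj (funext fun μ => by simpa using h (Finset.mem_univ μ))

/-- THE COMB AXIS IS ACTIVE AND MAXIMAL: for `j ≠ 0`, `j_{axis j} ≠ 0` and `j_ν = 0` for every `ν > axis j`. [cite: Balaban1984PropagatorsI, (1.7) p.18] -/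
theorem kingCombAxis_spec {j : Fin (d + 1) → Fin L} (hj : j ≠ 0) :
    j (kingCombAxis d j) ≠ 0 ∧ ∀ ν, kingCombAxis d j < ν → j ν = 0 := by
  have hne := (filter_ne_zero_nonempty_iff j).mpr hj
  have hax : kingCombAxis d j = (univ.filter fun μ => j μ ≠ 0).max' hne := by simp [kingCombAxis, hne]
  refine ⟨?_, fun ν hν => ?_⟩
  · have := Finset.max'_mem _ hne
    rw [← hax] at this
    simpa using this
  · by_contra h
    have hmem : ν ∈ univ.filter fun μ => j μ ≠ 0 := by simp [h]
    have := Finset.le_max' _ ν hmem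
    rw [← hax] at this
    exact absurd hν (not_lt.mpr this)

/-- The comb parent's coordinates: `(parent j)_ν = j_ν − [ν = axis j]` for `j ≠ 0`. [cite: Balaban1984PropagatorsI, (1.7) p.18] -/
theorem kingCombParent_apply {j : Fin (d + 1) → Fin L} (hj : j ≠ 0) (ν : Fin (d + 1)) :
    ((kingCombParent d j ν : ℕ)) = (j ν : ℕ) - (if ν = kingCombAxis d j then 1 else 0) := by
  have hne := (filter_ne_zero_nonempty_iff j).mpr hj
  simp only [kingCombParent, hne, if_true]
  by_cases hν : ν = kingCombAxis d j
  · subst hν; rw [Function.update_self, if_pos rfl]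
  · rw [Function.update_of_ne hν, if_neg hν, Nat.sub_zero]

omit [NeZero L] in
/-- The comb parent of `0` is `0`. [folklore] -/
theorem kingCombParent_zero [NeZero L] : kingCombParent d (0 : Fin (d + 1) → Fin L) = 0 := by
  have : ¬ (univ.filter fun μ => (0 : Fin (d + 1) → Fin L) μ ≠ 0).Nonempty := by
    rw [filter_ne_zero_nonempty_iff]; exact fun h => h rfl
  rw [kingCombParent, if_neg this]

/-- One bond less: `|parent j| + 1 = |j|` for `j ≠ 0`. [cite: Balaban1984PropagatorsI, (1.7) p.18] -/
theorem kingCombDepth_parent {j : Fin (d + 1) → Fin L} (hj : j ≠ 0) : kingCombDepth d (kingCombParent d j) + 1 = kingCombDepth d j := by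
  have hax := (kingCombAxis_spec hj).1
  have hpos : 1 ≤ (j (kingCombAxis d j) : ℕ) := by
    rcases Nat.eq_zero_or_pos (j (kingCombAxis d j) : ℕ) with h | h
    · exact absurd (Fin.ext h) hax
    · exact h
  unfold kingCombDepth
  rw [← Finset.add_sum_erase _ _ (Finset.mem_univ (kingCombAxis d j)), ← Finset.add_sum_erase _ (fun μ => (j μ : ℕ)) (Finset.mem_univ (kingCombAxis d j))]
  have hrest : ∑ μ ∈ univ.erase (kingCombAxis d j), (kingCombParent d j μ : ℕ) = ∑ μ ∈ univ.erase (kingCombAxis d j), (j μ : ℕ) :=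
    Finset.sum_congr rfl fun μ hμ => by rw [kingCombParent_apply hj, if_neg (Finset.ne_of_mem_erase hμ), Nat.sub_zero]
  rw [hrest, kingCombParent_apply hj, if_pos rfl]
  omega

omit [NeZero L] in
/-- Only the corner has comb depth `0`. [folklore] -/
theorem eq_zero_of_kingCombDepth_eq_zero [NeZero L] {j : Fin (d + 1) → Fin L} (h : kingCombDepth d j = 0) : j = 0 := by
  unfold kingCombDepth at h
  rw [Finset.sum_eq_zero_iff] at h
  exact funext fun μ => Fin.ext (by simpa using h μ (Finset.mem_univ μ))

variable (d L)

/-- ★ THE COMB TREE CONTOUR SYSTEM of a block of side `L` in `d+1` dimensions (King's (2.12) at one level; Bałaban's (1.7); Federbush's «Balaban axial gauge» tree).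
[cite: Balaban1984PropagatorsI, (1.7) p.18; King1986, (2.12) p.653; Federbush1987PhaseCellIII, §5.3 p.303] -/
def kingComb : BlockTree d L where
  root := 0
  parent := kingCombParent d
  depth := kingCombDepth d
  depth_root := by simp [kingCombDepth]
  depth_parent := fun j hj => kingCombDepth_parent hj
  eq_root_of_depth_eq_zero := fun j hj => eq_zero_of_kingCombDepth_eq_zero hj
  root_eq := rfl
  axis := kingCombAxis d
  step := fun j hj ν => by
    rw [kingCombParent_apply hj]
    by_cases hν : ν = kingCombAxis d j
    · subst hν
      rw [if_pos rfl]
      have hax := (kingCombAxis_spec hj).1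
      have hpos : 1 ≤ (j (kingCombAxis d j) : ℕ) := by
        rcases Nat.eq_zero_or_pos (j (kingCombAxis d j) : ℕ) with h | h
        · exact absurd (Fin.ext h) hax
        · exact h
      omega
    · rw [if_neg hν]; rfl

variable {d L}

/-- The comb's fields, by name. [folklore] -/
@[simp] theorem kingComb_root : (kingComb d L).root = 0 := rfl
/-- The comb's parent map. [folklore] -/
@[simp] theorem kingComb_parent : (kingComb d L).parent = kingCombParent d := rfl
/-- The comb's axis map. [folklore] -/
@[simp] theorem kingComb_axis : (kingComb d L).axis = kingCombAxis d := rfl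
/-- The comb's depth. [folklore] -/
@[simp] theorem kingComb_depth : (kingComb d L).depth = kingCombDepth d := rfl

/-- THE COMB IS SHALLOW: every contour has at most `(d+1)(L−1)` bonds. [cite: Balaban1984PropagatorsI, (1.7) p.18] -/
theorem kingComb_depth_le (j : Fin (d + 1) → Fin L) : (kingComb d L).depth j ≤ (d + 1) * (L - 1) := by
  show ∑ μ, (j μ : ℕ) ≤ (d + 1) * (L - 1)
  calc ∑ μ, (j μ : ℕ) ≤ ∑ _μ : Fin (d + 1), (L - 1) := Finset.sum_le_sum fun μ _ => by have := (j μ).isLt; omega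
    _ = (d + 1) * (L - 1) := by rw [Finset.sum_const, Finset.card_univ, Fintype.card_fin, smul_eq_mul]

/-- ON THE COMB EVERY COORDINATE BEYOND THE AXIS VANISHES, also for the parent: for `j ≠ 0` and `ν > axis j`, `j_ν = 0` and `(parent j)_ν = 0` — the comb bond into `j` starts at a
point of the coordinate sub-box spanned by `e₀,…,e_{axis j}`. [cite: Balaban1984PropagatorsI, (1.7) p.18; Federbush1987PhaseCellIII, §5.3 p.303] -/
theorem kingComb_apply_eq_zero_of_lt {j : Fin (d + 1) → Fin L} (hj : j ≠ 0) {ν : Fin (d + 1)} (hν : kingCombAxis d j < ν) :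
    j ν = 0 ∧ kingCombParent d j ν = 0 := by
  have h1 := (kingCombAxis_spec hj).2 ν hν
  refine ⟨h1, Fin.ext ?_⟩
  rw [kingCombParent_apply hj, if_neg (ne_of_gt hν), h1]; rfl

end Comb

/-! ## §3 Parallel transport along the contours -/

section Transport

variable {𝕜 : Type*} [RCLike 𝕜] {n : Type*} [Fintype n] [DecidableEq n]

/-- THE TRANSPORT `U(Γ_{y,x})` ALONG THE CONTOUR from the corner `y` of block `b` to `x = site b j`: the ordered product of the link matrices of the contour bonds, the bond nearest
the corner leftmost (`U(x,μ)` carries the fibre at `x+e_μ` to the fibre at `x`), so `U(Γ_{y,x})` carries the fibre at `x` to the fibre at `y`.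
[cite: Balaban1985BackgroundPropagators, (3.19) p.393; King1986, (2.11)–(2.12) p.653] -/
def treeHol (T : BlockTree d L) (U : Tor (fine L M) × Fin (d + 1) → Matrix n n 𝕜) (b : Tor M) (j : Fin (d + 1) → Fin L) : Matrix n n 𝕜 :=
  if _h : j = T.root then 1 else treeHol T U b (T.parent j) * U (site L M b (T.parent j), T.axis j)
termination_by T.depth j
decreasing_by exact T.depth_parent_lt (by assumption)

omit hM in
/-- No transport at the corner. [cite: Balaban1985BackgroundPropagators, (3.19) p.393] -/
theorem treeHol_root (U : Tor (fine L M) × Fin (d + 1) → Matrix n n 𝕜) (b : Tor M) : treeHol M T U b T.root = 1 := by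
  rw [treeHol]; simp

omit hM in
/-- One more bond: `U(Γ_{y,x}) = U(Γ_{y,x⁻})·U(x⁻, μ)`, `x⁻ = site b (parent j)`, `μ = axis j`. [cite: Balaban1985BackgroundPropagators, (3.19) p.393; King1986, (2.12) p.653] -/
theorem treeHol_of_ne_root (U : Tor (fine L M) × Fin (d + 1) → Matrix n n 𝕜) (b : Tor M) {j : Fin (d + 1) → Fin L} (hj : j ≠ T.root) :
    treeHol M T U b j = treeHol M T U b (T.parent j) * U (site L M b (T.parent j), T.axis j) := by
  rw [treeHol, dif_neg hj]

/-- Induction along the contours: a property of offsets holding at the corner and inherited from the parent holds everywhere. [folklore] -/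
theorem BlockTree.induction {P : (Fin (d + 1) → Fin L) → Prop} (h0 : P T.root) (hstep : ∀ j, j ≠ T.root → P (T.parent j) → P j) : ∀ j, P j := by
  suffices h : ∀ m j, T.depth j ≤ m → P j from fun j => h _ j le_rfl
  intro m
  induction m with
  | zero => intro j hj; rw [T.eq_root_of_depth_eq_zero j (Nat.le_zero.mp hj)]; exact h0
  | succ m ih =>
    intro j hj
    by_cases h : j = T.root
    · rw [h]; exact h0
    · have := T.depth_parent j h
      exact hstep j h (ih _ (by omega))

omit hM in
/-- ★ THE TRANSPORT IS UNITARY for a unitary link field. [cite: Balaban1985BackgroundPropagators, (3.19) p.393] -/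
theorem treeHol_mem_unitaryGroup {U : Tor (fine L M) × Fin (d + 1) → Matrix n n 𝕜} (hU : ∀ bd, U bd ∈ Matrix.unitaryGroup n 𝕜) (b : Tor M) :
    ∀ j, treeHol M T U b j ∈ Matrix.unitaryGroup n 𝕜 := by
  refine T.induction (P := fun j => treeHol M T U b j ∈ Matrix.unitaryGroup n 𝕜) ?_ fun j hj ih => ?_
  · rw [treeHol_root]; exact Submonoid.one_mem _
  · rw [treeHol_of_ne_root T M U b hj]; exact Submonoid.mul_mem _ ih (hU _)

omit hM in
/-- ★ NO TRANSPORT AT `U ≡ 1`: `1(Γ_{y,x}) = 1` — then [B9] (3.19) is King's plain block mean (2.11)∕(4.1). [cite: King1986, (2.11) p.653; Balaban1985BackgroundPropagators, (3.19) p.393] -/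
theorem treeHol_const_one (b : Tor M) : ∀ j, treeHol M T (fun _ => (1 : Matrix n n 𝕜)) b j = 1 := by
  refine T.induction (P := fun j => treeHol M T (fun _ => (1 : Matrix n n 𝕜)) b j = 1) (treeHol_root T M _ b) fun j hj ih => ?_
  rw [treeHol_of_ne_root T M _ b hj, ih, Matrix.one_mul]

omit hM in
/-- The transport only reads the link field on the contour bonds: two fields that agree on every bond `(site b (parent j), axis j)` of the block have the same transports there. [folklore] -/
theorem treeHol_congr_block {U V : Tor (fine L M) × Fin (d + 1) → Matrix n n 𝕜} (b : Tor M)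
    (h : ∀ j, j ≠ T.root → U (site L M b (T.parent j), T.axis j) = V (site L M b (T.parent j), T.axis j)) : ∀ j, treeHol M T U b j = treeHol M T V b j := by
  refine T.induction (P := fun j => treeHol M T U b j = treeHol M T V b j) (by rw [treeHol_root, treeHol_root]) fun j hj ih => ?_
  rw [treeHol_of_ne_root T M U b hj, treeHol_of_ne_root T M V b hj, ih, h j hj]

omit hM in
/-- ★★ **GAUGE COVARIANCE OF THE TRANSPORT** ([B9] (3.32) in the model): `U^g(Γ_{y,x}) = g(y)·U(Γ_{y,x})·g(x)^*` for every unitary gauge `g`, `U^g(x,μ) = g(x)U(x,μ)g(x+e_μ)^*` (Ͱ-a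
`kingGaugeAct`) — the inner `g`'s cancel bond after bond along the contour. [cite: Balaban1985BackgroundPropagators, (3.32) p.395, (3.28) p.395] -/
theorem treeHol_kingGaugeAct {g : Tor (fine L M) → Matrix n n 𝕜} (hg : ∀ x, g x ∈ Matrix.unitaryGroup n 𝕜) (U : Tor (fine L M) × Fin (d + 1) → Matrix n n 𝕜) (b : Tor M) :
    ∀ j, treeHol M T (kingGaugeAct (fine L M) g U) b j = g (site L M b T.root) * treeHol M T U b j * (g (site L M b j))ᴴ := by
  have hgg : ∀ x, (g x)ᴴ * g x = 1 := fun x => by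
    have := Matrix.mem_unitaryGroup_iff'.mp (hg x); simpa only [star_eq_conjTranspose] using this
  have hgg' : ∀ x, g x * (g x)ᴴ = 1 := fun x => by
    have := Matrix.mem_unitaryGroup_iff.mp (hg x); simpa only [star_eq_conjTranspose] using this
  refine T.induction (P := fun j => treeHol M T (kingGaugeAct (fine L M) g U) b j = g (site L M b T.root) * treeHol M T U b j * (g (site L M b j))ᴴ) ?_ fun j hj ih => ?_
  · rw [treeHol_root, treeHol_root, Matrix.mul_one, hgg']
  · rw [treeHol_of_ne_root T M _ b hj, treeHol_of_ne_root T M U b hj, ih]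
    simp only [kingGaugeAct]
    rw [← site_eq_parent_add_unitVec T M b hj]
    -- g(y) H g(p)^* · (g(p) U g(x)^*) = g(y) (H U) g(x)^*
    calc g (site L M b T.root) * treeHol M T U b (T.parent j) * (g (site L M b (T.parent j)))ᴴ * (g (site L M b (T.parent j)) * U (site L M b (T.parent j), T.axis j) * (g (site L M b j))ᴴ)
        = g (site L M b T.root) * treeHol M T U b (T.parent j) * ((g (site L M b (T.parent j)))ᴴ * g (site L M b (T.parent j))) * U (site L M b (T.parent j), T.axis j) * (g (site L M b j))ᴴ := by
          simp only [Matrix.mul_assoc]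
      _ = g (site L M b T.root) * (treeHol M T U b (T.parent j) * U (site L M b (T.parent j), T.axis j)) * (g (site L M b j))ᴴ := by
          rw [hgg, Matrix.mul_one]; simp only [Matrix.mul_assoc]

end Transport

end Summit.QuantumFields.YangMills.BalabanUVNodes.N15KingModelRung.CovariantBlock

end
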